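import Summits.Ventures.Crystal3D.Theorems.StickyWulffConstantGenericWallFloorLineCountGeneral
import HarnessLib

/-!
# Periodic polygonal lines crossing a plane: the CROSSING-SITE count (zigzag flux, deliverable 2a)
# (crux `GenericWallFloor`, stmt-Ventures-19480, line `WallLedgerG`; lane T's flux count, cf-p1 ROUTE §86(46))

HONEST FRAMING. Venture `Summits/Ventures/Crystal3D` (cell `crystal3d-full`), helper `--supports` the crux `GenericWallFloor`
(stmt-Ventures-19480) of `route-Ventures-StickyWulffConstant`, registered line `WallLedgerG`, open stub `stub_twoSlabAdhesion`.
Rung credit only; F-C1 not moved; NOT the stub.  Pure Euclidean geometry and counting in `ℝ³`; nothing about packings.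

THE ABSTRACT ZIGZAG COUNT.  A `p`-PERIODIC POLYGONAL PATH `γ : ℤ → ℝ³` (`γ (k + p) = γ k + D`, steps of length `≤ 1`)
and a plane frame `Ea, Eb` generate the family of translated paths ("lines") `k ↦ γ k + a•Ea + b•Eb + s`, `(a, b) ∈ ℤ²` — for
a periodic Barlow plate: `γ` = the walker's zigzag through the origin site (per-bilayer steepest bond), `Ea, Eb` = the layer
lattice basis, `D` = the period vector, `det(Ea, Eb, D)² = V²` with `V = p/√2`.  A CROSSING SITE of height `H` (direction `ν`)
is a path site `γ k + a•Ea + b•Eb + s` with `⟪predecessor, ν⟫ < H ≤ ⟪site, ν⟫`.  If the net rise per period `⟪D, ν⟫` is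
positive, every line whose class-`0` site lies in the window `[H − ⟪D,ν⟫, H]` has a crossing site within `p` steps of it
(discrete intermediate value theorem, `exists_crossing_index`), distinct lines have distinct crossing sites (`hinj`: the
lines are distinct point sets), and the `(V, D)` line count `lineCount_covolume_window` (radius `ρ − p`) gives

* **`periodicLines_crossings_ge`** — `(⟪D,ν⟫ / V)·π·ρ² − (π / V)·(4(‖Ea‖ + ‖Eb‖)‖D‖ + ‖D‖² + 2‖D‖·p)·ρ ≤ #T` for every finite
  `T` containing all crossing sites of lateral size `‖q‖² − ⟪q,ν⟫² ≤ ρ²`.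
For a Barlow plate `⟪D,ν⟫/V = √2·(mean ν-rise per layer)` = lane T's `plateFlux` averaged over a period (memo
WALKER-COVERAGE-g7 §3: `κ = √2⟨r⟩`); the instantiation (path = steepest-bond zigzag, `V = p/√2`, `‖D‖ ≤ 2p`, injectivity from
`le_dist_barlowPos`) is deliverable 2b.

WHAT THIS IS NOT: no walker semantics (validity / certification / orbit-freeness of the start states built on the crossing
sites are `…CapStart*`'s business); aperiodic words are not covered (cf-p1 §86(46): zigzag residual); F-C1 not moved.
-/

noncomputable section

namespace Summit.Ventures.Crystal3D.Theorems

open Summit.Ventures.Crystal3D Finset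
open scoped InnerProductSpace

/-- **Discrete intermediate value theorem.**  `f 0 < H ≤ f n` ⇒ some `k < n` has `f k < H ≤ f (k + 1)`. -/
theorem exists_crossing_index (f : ℕ → ℝ) (H : ℝ) (n : ℕ) (h0 : f 0 < H) (hn : H ≤ f n) :
    ∃ k, k < n ∧ f k < H ∧ H ≤ f (k + 1) := by
  induction n with
  | zero => exact absurd hn (not_le.2 h0)
  | succ n ih =>
    by_cases h : H ≤ f n
    · obtain ⟨k, hk, h1, h2⟩ := ih h
      exact ⟨k, Nat.lt_succ_of_lt hk, h1, h2⟩
    · exact ⟨n, n.lt_succ_self, not_le.1 h, hn⟩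

/-- Iterating the period: `γ (k + t·p) = γ k + t•D`. -/
theorem periodicPath_add_mul (γ : ℤ → EuclideanSpace ℝ (Fin 3)) (D : EuclideanSpace ℝ (Fin 3)) (p : ℕ)
    (hper : ∀ k, γ (k + p) = γ k + D) (k t : ℤ) : γ (k + t * p) = γ k + (t : ℝ) • D := by
  induction t using Int.induction_on with
  | zero => simp
  | succ n ih =>
    rw [add_mul, one_mul, ← add_assoc, hper, ih]
    push_cast
    module
  | pred n ih =>
    have h := hper (k + (-(n : ℤ) - 1) * p)
    rw [show k + (-(n : ℤ) - 1) * p + p = k + (-(n : ℤ)) * p by ring, ih] at h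
    rw [eq_sub_of_add_eq h.symm]
    push_cast
    module

/-- Steps of length `≤ 1` ⇒ `‖γ (k + m) − γ k‖ ≤ m`. -/
theorem norm_periodicPath_sub_le (γ : ℤ → EuclideanSpace ℝ (Fin 3)) (hstep : ∀ k, ‖γ (k + 1) - γ k‖ ≤ 1) (k : ℤ)
    (m : ℕ) : ‖γ (k + m) - γ k‖ ≤ m := by
  induction m with
  | zero => simp
  | succ m ih =>
    calc ‖γ (k + ((m + 1 : ℕ) : ℤ)) - γ k‖ = ‖(γ (k + m + 1) - γ (k + m)) + (γ (k + m) - γ k)‖ := by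
          push_cast; rw [← add_assoc]; congr 1; abel
      _ ≤ ‖γ (k + m + 1) - γ (k + m)‖ + ‖γ (k + m) - γ k‖ := norm_add_le _ _
      _ ≤ 1 + m := add_le_add (hstep _) ih
      _ = ((m + 1 : ℕ) : ℝ) := by push_cast; ring

/-- Two-sided form: `‖γ i − γ j‖ ≤ |i − j|`. -/
theorem norm_periodicPath_sub_le_abs (γ : ℤ → EuclideanSpace ℝ (Fin 3)) (hstep : ∀ k, ‖γ (k + 1) - γ k‖ ≤ 1)
    (i j : ℤ) : ‖γ i - γ j‖ ≤ |((i - j : ℤ) : ℝ)| := by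
  rcases le_or_gt j i with hij | hij
  · obtain ⟨m, hm⟩ := Int.eq_ofNat_of_zero_le (sub_nonneg.2 hij)
    have hi : i = j + m := by rw [← hm]; ring
    rw [hi, show j + (m : ℤ) - j = (m : ℤ) by ring]
    push_cast
    rw [abs_of_nonneg (Nat.cast_nonneg _)]
    exact norm_periodicPath_sub_le γ hstep j m
  · obtain ⟨m, hm⟩ := Int.eq_ofNat_of_zero_le (sub_nonneg.2 hij.le)
    have hj : j = i + m := by rw [← hm]; ring
    rw [norm_sub_rev, hj, show i - (i + (m : ℤ)) = -(m : ℤ) by ring]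
    push_cast
    rw [abs_neg, abs_of_nonneg (Nat.cast_nonneg _)]
    exact norm_periodicPath_sub_le γ hstep i m

/-- The lateral part is linear: `lat x − lat y = lat (x − y)`. -/
theorem lateral_sub (ν x y : EuclideanSpace ℝ (Fin 3)) :
    (x - ⟪x, ν⟫_ℝ • ν) - (y - ⟪y, ν⟫_ℝ • ν) = (x - y) - ⟪x - y, ν⟫_ℝ • ν := by
  rw [inner_sub_left, sub_smul]; abel

/-- The lateral part does not increase the norm (`ν` unit). -/
private theorem norm_lateral_le_unit' (ν v : EuclideanSpace ℝ (Fin 3)) (hν : ‖ν‖ = 1) :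
    ‖v - ⟪v, ν⟫_ℝ • ν‖ ≤ ‖v‖ := by
  have h : ‖v - ⟪v, ν⟫_ℝ • ν‖ ^ 2 ≤ ‖v‖ ^ 2 := by
    rw [norm_sub_inner_smul_sq ν v hν]; nlinarith [sq_nonneg ⟪v, ν⟫_ℝ]
  exact (pow_le_pow_iff_left₀ (norm_nonneg _) (norm_nonneg _) two_ne_zero).1 h

/-- **Crossing sites of a periodic line family (zigzag flux count).**  `ν` unit; `γ : ℤ → ℝ³` a path with period `p ≠ 0`
and period vector `D` (`γ (k + p) = γ k + D`), steps of length `≤ 1`; plane frame `Ea, Eb` with `det(Ea, Eb, D)² = V²`,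
`V > 0`; the lines `k ↦ γ k + a•Ea + b•Eb` (`(a,b) ∈ ℤ²`) pairwise distinct as point sets (`hinj`); net rise `⟪D, ν⟫ > 0`.
If a finite `T` contains every CROSSING SITE `q = γ k + a•Ea + b•Eb + s` of height `H` (`⟪γ (k−1) + a•Ea + b•Eb + s, ν⟫ < H ≤
⟪q, ν⟫`) with `‖q‖² − ⟪q,ν⟫² ≤ ρ²`, then
`(⟪D,ν⟫ / V)·π·ρ² − (π / V)·(4(‖Ea‖ + ‖Eb‖)‖D‖ + ‖D‖² + 2‖D‖·p)·ρ ≤ #T`. -/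
theorem periodicLines_crossings_ge (ν : EuclideanSpace ℝ (Fin 3)) (hν : ‖ν‖ = 1)
    (γ : ℤ → EuclideanSpace ℝ (Fin 3)) (Ea Eb D s : EuclideanSpace ℝ (Fin 3)) (p : ℕ) (hp : p ≠ 0)
    (hper : ∀ k, γ (k + p) = γ k + D) (hstep : ∀ k, ‖γ (k + 1) - γ k‖ ≤ 1)
    (V : ℝ) (hV : 0 < V) (hdet : (Matrix.det ![WithLp.ofLp Ea, WithLp.ofLp Eb, WithLp.ofLp D]) ^ 2 = V ^ 2)
    (hα : 0 < ⟪D, ν⟫_ℝ)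
    (hinj : ∀ k a b k' a' b' : ℤ, γ k + (a : ℝ) • Ea + (b : ℝ) • Eb = γ k' + (a' : ℝ) • Ea + (b' : ℝ) • Eb →
      a = a' ∧ b = b')
    (H ρ : ℝ) (hρ : 0 ≤ ρ) (T : Finset (EuclideanSpace ℝ (Fin 3)))
    (hT : ∀ k a b : ℤ, ⟪γ (k - 1) + (a : ℝ) • Ea + (b : ℝ) • Eb + s, ν⟫_ℝ < H →
      H ≤ ⟪γ k + (a : ℝ) • Ea + (b : ℝ) • Eb + s, ν⟫_ℝ →
      ‖γ k + (a : ℝ) • Ea + (b : ℝ) • Eb + s‖ ^ 2 - ⟪γ k + (a : ℝ) • Ea + (b : ℝ) • Eb + s, ν⟫_ℝ ^ 2 ≤ ρ ^ 2 →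
      γ k + (a : ℝ) • Ea + (b : ℝ) • Eb + s ∈ T) :
    ⟪D, ν⟫_ℝ / V * Real.pi * ρ ^ 2 -
        Real.pi / V * (4 * (‖Ea‖ + ‖Eb‖) * ‖D‖ + ‖D‖ ^ 2 + 2 * ‖D‖ * p) * ρ ≤ (T.card : ℝ) := by
  classical
  have hTnn : (0 : ℝ) ≤ (T.card : ℝ) := Nat.cast_nonneg _
  have hπV : 0 < Real.pi / V := div_pos Real.pi_pos hV
  set α : ℝ := ⟪D, ν⟫_ℝ with hαdef
  set d : ℝ := ‖D‖ with hddef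
  have hd0 : 0 ≤ d := norm_nonneg _
  have hp0 : (0 : ℝ) ≤ p := Nat.cast_nonneg _
  have hαle : α ≤ d := by
    have h := abs_real_inner_le_norm D ν; rw [hν, mul_one] at h; exact (le_abs_self _).trans h
  -- the small-ρ case
  by_cases hρp : ρ < p
  · have h1 : α / V * Real.pi * ρ ^ 2 ≤ Real.pi / V * (d * p) * ρ := by
      have e : α / V * Real.pi * ρ ^ 2 = Real.pi / V * (α * ρ) * ρ := by ring
      rw [e]
      apply mul_le_mul_of_nonneg_right _ hρ
      apply mul_le_mul_of_nonneg_left _ hπV.le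
      exact mul_le_mul hαle hρp.le hρ hd0
    have h2 : Real.pi / V * (d * p) * ρ ≤ Real.pi / V * (4 * (‖Ea‖ + ‖Eb‖) * d + d ^ 2 + 2 * d * p) * ρ := by
      apply mul_le_mul_of_nonneg_right _ hρ
      apply mul_le_mul_of_nonneg_left _ hπV.le
      nlinarith [norm_nonneg Ea, norm_nonneg Eb, mul_nonneg hd0 hp0]
    linarith
  push Not at hρp
  set ρ' : ℝ := ρ - p with hρ'def
  have hρ'0 : 0 ≤ ρ' := by rw [hρ'def]; linarith
  -- the line family's index set: (a, b) ↦ its site in T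
  set site : ℤ → ℤ → ℤ → EuclideanSpace ℝ (Fin 3) := fun k a b => γ k + (a : ℝ) • Ea + (b : ℝ) • Eb + s with hsite
  set f : EuclideanSpace ℝ (Fin 3) → Finset (ℤ × ℤ) := fun x =>
    if hx : ∃ kab : ℤ × ℤ × ℤ, site kab.1 kab.2.1 kab.2.2 = x then {((Classical.choose hx).2.1, (Classical.choose hx).2.2)}
    else ∅ with hf
  have hfcard : ∀ x, (f x).card ≤ 1 := by
    intro x; simp only [hf]; split_ifs <;> simp
  have hfmem : ∀ k a b, (a, b) ∈ f (site k a b) := by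
    intro k a b
    have hx : ∃ kab : ℤ × ℤ × ℤ, site kab.1 kab.2.1 kab.2.2 = site k a b := ⟨(k, a, b), rfl⟩
    simp only [hf, dif_pos hx, Finset.mem_singleton]
    have hc := Classical.choose_spec hx
    simp only [hsite] at hc
    have := hinj _ _ _ _ _ _ (add_right_cancel hc)
    rw [Prod.mk.injEq]; exact ⟨this.1.symm, this.2.symm⟩
  set TL : Finset (ℤ × ℤ) := T.biUnion f with hTL
  have hTLcard : (TL.card : ℝ) ≤ (T.card : ℝ) := by
    have h1 : TL.card ≤ ∑ x ∈ T, (f x).card := Finset.card_biUnion_le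
    have h2 : ∑ x ∈ T, (f x).card ≤ ∑ _x ∈ T, 1 := Finset.sum_le_sum fun x _ => hfcard x
    rw [Finset.sum_const, smul_eq_mul, mul_one] at h2
    exact_mod_cast h1.trans h2
  -- the (V, D) line count for the class-0 sites γ(t p) + a Ea + b Eb + s = a Ea + b Eb + t D + (γ 0 + s)
  have hcount := lineCount_covolume_window ν hν α ρ' (H - α) V hV hρ'0 Ea Eb D (γ 0 + s) hdet
    (by rw [abs_of_pos hα]) TL ?_
  swap
  · intro a b t hlo hhi hlat
    -- the window point is the class-0 site of line (a, b) in period t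
    have hP : (a : ℝ) • Ea + (b : ℝ) • Eb + (t : ℝ) • D + (γ 0 + s) = site (t * p) a b := by
      simp only [hsite]
      have h := periodicPath_add_mul γ D p hper 0 t
      rw [zero_add] at h
      rw [h]; abel
    rw [hP] at hlo hhi hlat
    -- heights along the line: one period down is below H, one period up is at least H
    set g : ℤ → ℝ := fun m => ⟪site m a b, ν⟫_ℝ with hg
    have hgper : ∀ m : ℤ, g (m + p) = g m + α := by
      intro m; simp only [hg, hsite]; rw [hper]
      simp only [inner_add_left]; rw [← hαdef]; ring
    have hlow : g (t * p - p) < H := by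
      have h := hgper (t * p - p); rw [sub_add_cancel] at h
      have h' : g (t * p) ≤ H - α + α := hhi
      linarith
    have hhigh : H ≤ g (t * p - p + ((2 * p : ℕ) : ℤ)) := by
      have e : t * p - p + ((2 * p : ℕ) : ℤ) = t * p + p := by push_cast; ring
      rw [e, hgper]
      have h' : H - α ≤ g (t * p) := hlo
      linarith
    obtain ⟨k, hk, hk1, hk2⟩ := exists_crossing_index (fun m : ℕ => g (t * p - p + m)) H (2 * p)
      (by simpa using hlow) hhigh
    -- the crossing site
    set m₀ : ℤ := t * p - p + ((k + 1 : ℕ) : ℤ) with hm₀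
    have hpred : ⟪site (m₀ - 1) a b, ν⟫_ℝ < H := by
      have e : m₀ - 1 = t * p - p + (k : ℤ) := by rw [hm₀]; push_cast; ring
      rw [e]; exact hk1
    have hself : H ≤ ⟪site m₀ a b, ν⟫_ℝ := hk2
    -- its lateral size: within p of the window point
    have hdist : ‖site m₀ a b - site (t * p) a b‖ ≤ p := by
      have e : site m₀ a b - site (t * p) a b = γ m₀ - γ (t * p) := by simp only [hsite]; abel
      rw [e]
      refine (norm_periodicPath_sub_le_abs γ hstep m₀ (t * p)).trans ?_
      rw [hm₀, abs_le]; push_cast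
      have hk' : (k : ℝ) + 1 ≤ 2 * p := by exact_mod_cast hk
      constructor <;> linarith
    have hlat0 : ‖site (t * p) a b - ⟪site (t * p) a b, ν⟫_ℝ • ν‖ ≤ ρ' := by
      have h2 : ‖site (t * p) a b - ⟪site (t * p) a b, ν⟫_ℝ • ν‖ ^ 2 ≤ ρ' ^ 2 := by
        rw [norm_sub_inner_smul_sq ν _ hν]; exact hlat
      exact (pow_le_pow_iff_left₀ (norm_nonneg _) hρ'0 two_ne_zero).1 h2
    have hlat1 : ‖site m₀ a b - ⟪site m₀ a b, ν⟫_ℝ • ν‖ ≤ ρ := by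
      have e : site m₀ a b - ⟪site m₀ a b, ν⟫_ℝ • ν =
          (site (t * p) a b - ⟪site (t * p) a b, ν⟫_ℝ • ν) +
            ((site m₀ a b - site (t * p) a b) - ⟪site m₀ a b - site (t * p) a b, ν⟫_ℝ • ν) := by
        rw [← lateral_sub]; abel
      rw [e]
      calc _ ≤ ‖site (t * p) a b - ⟪site (t * p) a b, ν⟫_ℝ • ν‖ +
            ‖(site m₀ a b - site (t * p) a b) - ⟪site m₀ a b - site (t * p) a b, ν⟫_ℝ • ν‖ := norm_add_le _ _
        _ ≤ ρ' + p := add_le_add hlat0 ((norm_lateral_le_unit' ν _ hν).trans hdist)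
        _ = ρ := by rw [hρ'def]; ring
    have hmem : site m₀ a b ∈ T := by
      refine hT m₀ a b hpred hself ?_
      rw [← norm_sub_inner_smul_sq ν _ hν]
      exact pow_le_pow_left₀ (norm_nonneg _) hlat1 2
    rw [hTL, Finset.mem_biUnion]
    exact ⟨site m₀ a b, hmem, hfmem m₀ a b⟩
  -- assemble
  rw [abs_of_pos hα] at hcount
  have hexp : α / V * Real.pi * ρ ^ 2 - Real.pi / V * (4 * (‖Ea‖ + ‖Eb‖) * d + d ^ 2 + 2 * d * p) * ρ ≤
      α / V * Real.pi * ρ' ^ 2 - Real.pi / V * (4 * (‖Ea‖ + ‖Eb‖) * d + d ^ 2) * ρ' := by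
    have e1 : α / V * Real.pi * ρ' ^ 2 = α / V * Real.pi * ρ ^ 2 - Real.pi / V * (2 * α * p) * ρ + α / V * Real.pi * p ^ 2 := by
      rw [hρ'def]; ring
    have h1 : Real.pi / V * (2 * α * p) * ρ ≤ Real.pi / V * (2 * d * p) * ρ := by
      apply mul_le_mul_of_nonneg_right _ hρ
      apply mul_le_mul_of_nonneg_left _ hπV.le
      nlinarith
    have h2 : Real.pi / V * (4 * (‖Ea‖ + ‖Eb‖) * d + d ^ 2) * ρ' ≤ Real.pi / V * (4 * (‖Ea‖ + ‖Eb‖) * d + d ^ 2) * ρ := by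
      apply mul_le_mul_of_nonneg_left (by rw [hρ'def]; linarith)
      exact mul_nonneg hπV.le (by positivity)
    have h3 : 0 ≤ α / V * Real.pi * p ^ 2 := by
      have : 0 ≤ α / V := div_nonneg hα.le hV.le
      positivity
    have e2 : Real.pi / V * (4 * (‖Ea‖ + ‖Eb‖) * d + d ^ 2 + 2 * d * p) * ρ =
        Real.pi / V * (4 * (‖Ea‖ + ‖Eb‖) * d + d ^ 2) * ρ + Real.pi / V * (2 * d * p) * ρ := by ring
    rw [e1, e2]; linarith
  linarith

end Summit.Ventures.Crystal3D.Theorems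

end
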